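import Summits.BirchSwinnertonDyer.BirchSwinnertonDyer.Theorems.ShaPrimaryTransferFiniteShaComponentTransferSelmerCubicDoor
import HarnessLib

/-!
# BirchSwinnertonDyer — the SEL2CUBIC door for a COMPLEX cubic `2`-division field: kernel general `2`-descent
# data (`admStd` sieve: norm + one real sign) ⟹ `t₂(E) = 0`, `Ш(E/ℚ)[2^∞] = 0`, `rank E(ℚ) = r`

HONEST FRAMING: route `ShaPrimaryTransfer`, seat `bsd-line-spt-p1` (g29), `--supports` item T =
`FiniteShaComponentTransfer` (stmt-22356), UNCHANGED (conjecture-grade at corank ≥ 2). BSD in rank ≥ 2 is NOT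
proved by any of this. THEOREMS ONLY.

Companion of `…SelmerCubicDoor` (totally real case, sieve `admStd3R`) for the census curves
`y² = x³ + Ax² + Bx + C` with `Δ_E < 0`: the `2`-division field `K = ℚ(θ)` is a complex cubic field with ONE real
embedding `ρ`, and the cell-`b2b-bsdr2` certificates (`Rank2Observatory<label>TwoDescRankTwo`, `admStd`/`admStdQ`)
sieve by the norm functional and the sign at `ρ`.

* `admStd_sound_of_invariants` — `N(ξ) ∈ ℚ²`, `ρ(ξ) > 0`, `ξ·∏_T w·∏_U g ∈ K²` ⟹ `admStd … T U`;
* `rho_pos_of_mem_selmerGroup_of_Δ_neg` — for `Δ_E < 0` the Cassels class of a `2`-Selmer class is positive at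
  every real embedding (Literature `TwoDescentOneRootRealPlace`, `Δ < 0` regime: `E(K_w) = E(ℝ)` connected);
* **`admStd_sound_sel`** — the sieve `admStd` accepts every pair realised by a `2`-Selmer class;
* **`shaCorank_two_eq_zero_of_admStd`**, **`shaCorank_two_eq_zero_of_admStdQ`** — primitive certificate data +
  `#adm ≤ 2^r` + `rank ≥ r` ⟹ `t₂(E) = 0 ∧ Ш(E/ℚ)[2^∞] = 0 ∧ rank E(ℚ) = r`, unconditionally.
[cite: Cassels1991LecturesEllipticCurves, §15] [cite: SilvermanAEC2009, Thm. X.4.2, Rem. X.4.1, Prop. X.1.4]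
[cite: CremonaAlgorithms1997, §3.6]
-/

-- single-conjunct summit: `Summit.BirchSwinnertonDyer.BirchSwinnertonDyer.…` repeats the name by design
set_option linter.dupNamespace false

noncomputable section

open scoped Classical NumberField

open Literature.NumberTheory.NumberFields Literature.NumberTheory.EllipticCurves
  Literature.NumberTheory.GaloisRepresentations Polynomial Module NumberField IsDedekindDomain
open WeierstrassCurve WeierstrassCurve.Affine

namespace Summit.BirchSwinnertonDyer.BirchSwinnertonDyer.Theorems.ShaPrimaryTransferSelmerCubicCover

open Summit.BirchSwinnertonDyer.BirchSwinnertonDyer.Rank2Observatory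
open Summit.BirchSwinnertonDyer.BirchSwinnertonDyer.Rank2Observatory.TwoDescCubic

variable {K : Type} [Field K] [NumberField K] {A B C : ℤ} {θ : 𝓞 K}

/-- **The standard sieve from the two invariants**: if `ξ ∈ Kˣ` has `N_{K/ℚ}(ξ) ∈ ℚ²` and `ρ(ξ) > 0`, then every
pair `(T, U)` with `ξ·∏_T w·∏_U g ∈ K²` passes `admStd` (certified norms `Nu, Ng` and sign bits at `ρ`). The
Selmer-class form of `admStd_sound`. [cite: Cassels1991LecturesEllipticCurves, §15] -/
theorem admStd_sound_of_invariants {m s : ℕ} (ρ : K →+* ℝ)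
    {w : Fin m → K} {g : Fin s → K} (hw0 : ∀ i, w i ≠ 0) (hg0 : ∀ j, g j ≠ 0)
    {Nu : Fin m → ℤ} (hNu : ∀ i, Algebra.norm ℚ (w i) = Nu i)
    {Ng : Fin s → ℤ} (hNg : ∀ j, Algebra.norm ℚ (g j) = Ng j)
    {su : Fin m → Bool} {sg : Fin s → Bool}
    (hsu : ∀ i, su i = true ↔ ρ (w i) < 0) (hsg : ∀ j, sg j = true ↔ ρ (g j) < 0)
    {ξ : K} (hξ0 : ξ ≠ 0) (hN : IsSquare (Algebra.norm ℚ ξ)) (hρ : 0 < ρ ξ)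
    (T : Finset (Fin m)) (U : Finset (Fin s)) (hsq : IsSquare (ξ * (∏ i ∈ T, w i) * ∏ j ∈ U, g j)) :
    admStd Nu Ng su sg T U = true := by
  set z := (∏ i ∈ T, w i) * ∏ j ∈ U, g j with hz
  have hsq' : IsSquare (ξ * z) := by rwa [hz, ← mul_assoc]
  have hz0 : z ≠ 0 := mul_ne_zero (Finset.prod_ne_zero_iff.mpr fun i _ => hw0 i)
    (Finset.prod_ne_zero_iff.mpr fun j _ => hg0 j)
  rw [admStd, Bool.and_eq_true, decide_eq_true_eq, decide_eq_true_eq]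
  refine ⟨?_, ?_⟩
  · -- the norm functional: `N(z) = N(r)² / N(ξ)` is a square
    obtain ⟨r, hr⟩ := hsq'
    obtain ⟨n, hn⟩ := hN
    have hn0 : n ≠ 0 := by
      intro h0; rw [h0, mul_zero] at hn
      exact (Algebra.norm_ne_zero_iff.mpr hξ0) hn
    have hmul : Algebra.norm ℚ ξ * Algebra.norm ℚ z = Algebra.norm ℚ r * Algebra.norm ℚ r := by
      rw [← map_mul, ← map_mul, hr]
    rw [hn] at hmul
    have hNz' : IsSquare (Algebra.norm ℚ z) := ⟨Algebra.norm ℚ r / n, by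
      rw [div_mul_div_comm, eq_div_iff (mul_ne_zero hn0 hn0)]; linear_combination hmul⟩
    have hNz : Algebra.norm ℚ z = (((∏ i ∈ T, Nu i) * ∏ j ∈ U, Ng j : ℤ) : ℚ) := by
      rw [hz, map_mul, map_prod, map_prod, Finset.prod_congr rfl (fun i _ => hNu i),
        Finset.prod_congr rfl (fun j _ => hNg j)]
      push_cast
      rfl
    rw [hNz, Rat.isSquare_intCast_iff] at hNz'
    exact hNz'
  · exact (even_card_iff_pos ρ hw0 hg0 hsu hsg T U).mpr (rho_pos_of_isSquare_mul ρ hρ hz0 hsq')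

/-- **For `Δ_E < 0` the Cassels class of a `2`-Selmer class is positive at every real embedding of the root
field**: `E/ℚ` as above with `Δ(E) < 0`, `ρ : K → ℝ`, `c ∈ Sel⁽²⁾(E/ℚ)` with `Φ(c) = [a]` ⟹ `0 < ρ(a)`
(`TwoDescentOneRootRealPlace`, `Δ < 0` regime, read through `K_w ≃ ℝ` at the place `w` of `ρ`).
[cite: SilvermanAEC2009, Prop. X.1.4 (v = ∞)] [cite: Cassels1991LecturesEllipticCurves, §15] -/
theorem rho_pos_of_mem_selmerGroup_of_Δ_neg (E : WeierstrassCurve ℚ) [E.IsElliptic] (ha₁ : E.a₁ = 0)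
    (ha₂ : E.a₂ = A) (ha₃ : E.a₃ = 0) (ha₄ : E.a₄ = B) (ha₆ : E.a₆ = C)
    (hθ : aeval (algebraMap (𝓞 K) K θ) (MonicCubic.poly A B C) = 0) [(E.baseChange K).IsElliptic]
    (ρ : K →+* ℝ) (hΔ : E.Δ < 0)
    {c : galH1Torsion E 2} (hc : c ∈ selmerGroup E 2) (a : Kˣ)
    (ha : kummerEquiv K 2 (E.oneRootDescentH1 K (isTwoTorsionX_of_aeval E ha₁ ha₂ ha₃ ha₄ ha₆ hθ) c) =
      Additive.ofMul (QuotientGroup.mk a)) :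
    0 < ρ (a : K) := by
  -- the real place of `ρ`
  set φ : K →+* ℂ := Complex.ofRealHom.comp ρ with hφ
  have hφr : ComplexEmbedding.IsReal φ := isReal_ofRealHom_comp K ρ
  set w : InfinitePlace K := InfinitePlace.mk φ with hw_def
  have hw : w.IsReal := ⟨φ, hφr, rfl⟩
  have hemb : InfinitePlace.embedding_of_isReal hw = ρ := embedding_of_isReal_mk_ofRealHom_comp K ρ hw
  have hread : ∀ x : K, InfinitePlace.Completion.extensionEmbeddingOfIsReal hw (algebraMap K w.Completion x) = ρ x := by
    intro x
    rw [InfinitePlace.Completion.algebraMap_apply, ← hemb]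
    exact InfinitePlace.Completion.extensionEmbeddingOfIsReal_coe hw (WithAbs.toAbs w.1 x)
  have hΔK : InfinitePlace.Completion.extensionEmbeddingOfIsReal hw
      (algebraMap K w.Completion (E.baseChange K).Δ) < 0 := by
    have hΔ' : (E.baseChange K).Δ = algebraMap ℚ K E.Δ := by
      show (E.map (algebraMap ℚ K)).Δ = _
      rw [map_Δ]
    rw [hΔ', hread]
    have hq : ρ (algebraMap ℚ K E.Δ) = ((E.Δ : ℚ) : ℝ) := eq_ratCast (ρ.comp (algebraMap ℚ K)) E.Δ
    rw [hq]
    exact_mod_cast hΔ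
  have key := E.pos_of_mem_selmerGroup_of_resTorsion_of_Δ_neg (isTwoTorsionX_of_aeval E ha₁ ha₂ ha₃ ha₄ ha₆ hθ)
    hc w hw hΔK a ha
  rwa [hread] at key

/-- **The standard sieve accepts every pair realised by a `2`-Selmer class** (= hypothesis `hadm` of
`natCard_selmerGroup_le_of_coverSet` for a complex cubic `2`-division field, `Δ_E < 0`): for `c ∈ Sel⁽²⁾(E/ℚ)` with
Cassels class `[a]` and `a·∏_T w·∏_U g ∈ K²`, `admStd … T U = true` (norm clause by `cor ∘ H¹(χ_θ) ∘ res = 0`,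
sign clause by the archimedean local condition). [cite: Cassels1991LecturesEllipticCurves, §15]
[cite: SilvermanAEC2009, Prop. X.1.4, Prop. X.4.9] -/
theorem admStd_sound_sel {m s : ℕ} (E : WeierstrassCurve ℚ) [E.IsElliptic] (ha₁ : E.a₁ = 0) (ha₂ : E.a₂ = A)
    (ha₃ : E.a₃ = 0) (ha₄ : E.a₄ = B) (ha₆ : E.a₆ = C) (hirr : Irreducible (MonicCubic.polyQ A B C))
    (hθ : aeval (algebraMap (𝓞 K) K θ) (MonicCubic.poly A B C) = 0) (h3 : finrank ℚ K = 3)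
    [(E.baseChange K).IsElliptic] (ρ : K →+* ℝ) (hΔ : E.Δ < 0)
    {w : Fin m → K} {g : Fin s → K} (hw0 : ∀ i, w i ≠ 0) (hg0 : ∀ j, g j ≠ 0)
    {Nu : Fin m → ℤ} (hNu : ∀ i, Algebra.norm ℚ (w i) = Nu i)
    {Ng : Fin s → ℤ} (hNg : ∀ j, Algebra.norm ℚ (g j) = Ng j)
    {su : Fin m → Bool} {sg : Fin s → Bool}
    (hsu : ∀ i, su i = true ↔ ρ (w i) < 0) (hsg : ∀ j, sg j = true ↔ ρ (g j) < 0)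
    {c : galH1Torsion E 2} (hc : c ∈ selmerGroup E 2) (a : Kˣ)
    (ha : kummerEquiv K 2 (E.oneRootDescentH1 K (isTwoTorsionX_of_aeval E ha₁ ha₂ ha₃ ha₄ ha₆ hθ) c) =
      Additive.ofMul (QuotientGroup.mk a))
    (T : Finset (Fin m)) (U : Finset (Fin s))
    (hsq : IsSquare ((a : K) * (∏ i ∈ T, w i) * ∏ j ∈ U, g j)) :
    admStd Nu Ng su sg T U = true :=
  admStd_sound_of_invariants ρ hw0 hg0 hNu hNg hsu hsg a.ne_zero
    (E.isSquare_norm_of_kummerEquiv_oneRootDescentH1_eq (irreducible_twoDivision E ha₁ ha₂ ha₃ ha₄ ha₆ hirr) h3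
      (isTwoTorsionX_of_aeval E ha₁ ha₂ ha₃ ha₄ ha₆ hθ) c a ha)
    (rho_pos_of_mem_selmerGroup_of_Δ_neg E ha₁ ha₂ ha₃ ha₄ ha₆ hθ ρ hΔ hc a ha) T U hsq

/-- **The SEL2CUBIC door, complex cubic field.** Let `E : y² = x³ + Ax² + Bx + C` over `ℚ` have `Δ(E) < 0` and
irreducible `2`-division cubic with root `θ ∈ 𝓞_K`, `[K : ℚ] = 3`, `𝓞_K` a PID, real embedding `ρ`; let `G`
enumerate (injectively, by primes) the primes above `F′(θ)`, `Wu` generate `𝓞_Kˣ/𝓞_Kˣ²`, with norms `Nu, Ng` and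
sign bits `su, sg` at `ρ`; let `adm` be any test implied by `admStd`. If the number of admissible pairs is `≤ 2^r`
and `rank E(ℚ) ≥ r`, then `t₂(E) = 0`, `Ш(E/ℚ)[2^∞] = 0` and `rank E(ℚ) = r` — unconditionally.
[cite: Cassels1991LecturesEllipticCurves, §15] [cite: SilvermanAEC2009, Thm. X.4.2, Rem. X.4.1] -/
theorem shaCorank_two_eq_zero_of_admStd [IsPrincipalIdealRing (𝓞 K)] (E : WeierstrassCurve ℚ) [E.IsElliptic]
    (ha₁ : E.a₁ = 0) (ha₂ : E.a₂ = A) (ha₃ : E.a₃ = 0) (ha₄ : E.a₄ = B) (ha₆ : E.a₆ = C)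
    (hirr : Irreducible (MonicCubic.polyQ A B C))
    (hθ : aeval (algebraMap (𝓞 K) K θ) (MonicCubic.poly A B C) = 0) (h3 : finrank ℚ K = 3)
    [(E.baseChange K).IsElliptic] (ρ : K →+* ℝ) (hΔ : E.Δ < 0)
    {s : ℕ} {G : Fin s → 𝓞 K} (hG : Function.Injective G) (hGp : ∀ j, Prime (G j))
    (hD : ∀ q : 𝓞 K, Prime q → q ∣ 3 * θ ^ 2 + 2 * A * θ + B → ∃ j, Associated q (G j))
    {m : ℕ} {Wu : Fin m → (𝓞 K)ˣ} (hW : ∀ u : (𝓞 K)ˣ, ∃ T : Finset (Fin m), IsSquare (u * ∏ i ∈ T, Wu i))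
    {Nu : Fin m → ℤ} (hNu : ∀ i, Algebra.norm ℚ (algebraMap (𝓞 K) K (Wu i)) = Nu i)
    {Ng : Fin s → ℤ} (hNg : ∀ j, Algebra.norm ℚ (algebraMap (𝓞 K) K (G j)) = Ng j)
    {su : Fin m → Bool} {sg : Fin s → Bool}
    (hsu : ∀ i, su i = true ↔ ρ (algebraMap (𝓞 K) K (Wu i)) < 0)
    (hsg : ∀ j, sg j = true ↔ ρ (algebraMap (𝓞 K) K (G j)) < 0)
    {adm : Finset (Fin m) → Finset (Fin s) → Bool}
    (hadm : ∀ T U, admStd Nu Ng su sg T U = true → adm T U = true)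
    {r : ℕ} (hcount : ((Finset.univ ×ˢ Finset.univ).filter
      (fun p : Finset (Fin m) × Finset (Fin s) => adm p.1 p.2 = true)).card ≤ 2 ^ r)
    (hrank : r ≤ E.mordellWeilRank) :
    E.shaCorank 2 = 0 ∧ AddCommGroup.primaryComponent E.sha 2 = ⊥ ∧ E.mordellWeilRank = r := by
  have hw0 : ∀ i, algebraMap (𝓞 K) K (Wu i) ≠ 0 := fun i =>
    (RingOfIntegers.coe_ne_zero_iff).mpr (Units.ne_zero _)
  have hg0 : ∀ j, algebraMap (𝓞 K) K (G j) ≠ 0 := fun j =>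
    (RingOfIntegers.coe_ne_zero_iff).mpr (hGp j).ne_zero
  have hle : Nat.card (selmerGroup E 2) ≤ 2 ^ r :=
    (natCard_selmerGroup_le_of_coverSet E ha₁ ha₂ ha₃ ha₄ ha₆ hirr hθ h3 hG (fun j => (hGp j).ne_zero) hD hW
      (adm := adm) (fun c hc a ha T U hsq => hadm T U
        (admStd_sound_sel E ha₁ ha₂ ha₃ ha₄ ha₆ hirr hθ h3 ρ hΔ hw0 hg0 hNu hNg hsu hsg hc a ha T U hsq))).trans
      hcount
  exact E.shaCorank_eq_zero_of_natCard_selmerGroup_le 2 hle hrank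

/-- **The SEL2CUBIC door, complex cubic field, residue form** — the same with the kernel-decidable residue test
`admStdQ Q` (square residues modulo the positive moduli `Q`) the certificates count with.
[cite: Cassels1991LecturesEllipticCurves, §15] [cite: SilvermanAEC2009, Thm. X.4.2, Rem. X.4.1] -/
theorem shaCorank_two_eq_zero_of_admStdQ [IsPrincipalIdealRing (𝓞 K)] (E : WeierstrassCurve ℚ) [E.IsElliptic]
    (ha₁ : E.a₁ = 0) (ha₂ : E.a₂ = A) (ha₃ : E.a₃ = 0) (ha₄ : E.a₄ = B) (ha₆ : E.a₆ = C)
    (hirr : Irreducible (MonicCubic.polyQ A B C))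
    (hθ : aeval (algebraMap (𝓞 K) K θ) (MonicCubic.poly A B C) = 0) (h3 : finrank ℚ K = 3)
    [(E.baseChange K).IsElliptic] (ρ : K →+* ℝ) (hΔ : E.Δ < 0)
    {s : ℕ} {G : Fin s → 𝓞 K} (hG : Function.Injective G) (hGp : ∀ j, Prime (G j))
    (hD : ∀ q : 𝓞 K, Prime q → q ∣ 3 * θ ^ 2 + 2 * A * θ + B → ∃ j, Associated q (G j))
    {m : ℕ} {Wu : Fin m → (𝓞 K)ˣ} (hW : ∀ u : (𝓞 K)ˣ, ∃ T : Finset (Fin m), IsSquare (u * ∏ i ∈ T, Wu i))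
    {Nu : Fin m → ℤ} (hNu : ∀ i, Algebra.norm ℚ (algebraMap (𝓞 K) K (Wu i)) = Nu i)
    {Ng : Fin s → ℤ} (hNg : ∀ j, Algebra.norm ℚ (algebraMap (𝓞 K) K (G j)) = Ng j)
    {su : Fin m → Bool} {sg : Fin s → Bool}
    (hsu : ∀ i, su i = true ↔ ρ (algebraMap (𝓞 K) K (Wu i)) < 0)
    (hsg : ∀ j, sg j = true ↔ ρ (algebraMap (𝓞 K) K (G j)) < 0)
    (Q : List ℕ) (hQ : ∀ q ∈ Q, 0 < q)
    {r : ℕ} (hcount : ((Finset.univ ×ˢ Finset.univ).filter (fun p : Finset (Fin m) × Finset (Fin s) =>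
      admStdQ Q Nu Ng su sg p.1 p.2 = true)).card ≤ 2 ^ r)
    (hrank : r ≤ E.mordellWeilRank) :
    E.shaCorank 2 = 0 ∧ AddCommGroup.primaryComponent E.sha 2 = ⊥ ∧ E.mordellWeilRank = r :=
  shaCorank_two_eq_zero_of_admStd E ha₁ ha₂ ha₃ ha₄ ha₆ hirr hθ h3 ρ hΔ hG hGp hD hW hNu hNg hsu hsg
    (adm := admStdQ Q Nu Ng su sg) (fun _ _ h => admStdQ_of_admStd hQ h) hcount hrank

end Summit.BirchSwinnertonDyer.BirchSwinnertonDyer.Theorems.ShaPrimaryTransferSelmerCubicCover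

end
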